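import Literature.RepresentationTheory.KonnoKonno2007.U21KAKSectionDifferentiable
import Literature.RepresentationTheory.KonnoKonno2007.RealUnitaryRankOneKAKFibers
import Literature.RepresentationTheory.BorelWallach2000.UpqMaximalCompactBlocks
import Literature.NumberTheory.Automorphic.GKModulesCurveLogChart
import Mathlib.Analysis.Calculus.FDeriv.Mul
import Mathlib.Analysis.Matrix.Normed
import HarnessLib

/-!
# The `KAK` section of `U(2,1)` along a torus translate `s ↦ g · a_s` («Φ2-geom» of ROAD-A6 at `U(2,1)`)

For the rank-one group `G = U(2,1)` with `K = U(2) × U(1)`, noncompact Cartan generator `H₀ = upqUnit (0,0) (−I)` and torus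
`a_t = hypV 0 0 t = exp (t H₀)`, ★ `U21KAKSection{,Group,Differentiable}` (S1b) give an explicit real-analytic section
`x = secK₁ x · a_{secT x} · secK₂ x` of `K × ℝ × K → G` off `K`.  This file packages, for a curve `s ↦ g · a_s` through a point
`g · a_{s₀} ∉ K`, the seven first-order data consumed by the torus-law derivative computation (Φ2-diff,
`hasDerivAt_inner_globOp_mul_hypV`): `K`-valued curves `k₁ k₂ : ℝ → K`, `τ : ℝ → ℝ`, log-derivatives `Y₁ Y₁' Y₂ ∈ 𝔨`, `τ' ∈ ℝ`, the local
factorisation `g a_s = kakMap 0 0 (k₁ s, τ s, k₂ s)`, the derivatives of the matrices of `k₁`, `k₁⁻¹`, `k₂` and of `τ` at `s₀`,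
`Y₁' = −Ad(k₁ s₀) Y₁`, and the derivative identity

  (E1) `Ad(a_{−τ s₀}) Y₁ + τ' • H₀ + Ad(k₂ s₀) Y₂ = Ad(k₂ s₀) H₀`

obtained by differentiating `g a_s = k₁(s) a_{τ(s)} k₂(s)` at `s₀` (product rule) against `(g a_s)' = (g a_s) H₀` and cancelling
`k₁(s₀) a_{τ s₀}` on the left and `k₂(s₀)` on the right.

Main result: `RealDualPair.exists_section_along_hypV`.  Helpers: `hasDerivAt_coe_mul_hypV`, `hasDerivAt_coe_inv_curve`.

HONEST LABEL: elementary multivariable calculus on the explicit `KAK` section of ★ S1b; no representation theory is used here.  Mathlib has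
the `KAK` decomposition for no real group; the tree's ★ `kakMap` ∕ ★ `secK₁` ∕ ★ `secT` ∕ ★ `secK₂` ∕ ★ `inv_mul_deriv_mem_compactLie` are reused,
nothing is restated.

References: A. W. Knapp, *Lie Groups Beyond an Introduction* (2nd ed., 2002), I §10 (Props. 1.87, 1.89: derivative of matrix curves,
`Ad`), VII §3 (Thm. 7.39: `KAK`); the `U(2,1)` normalisation follows Konno–Konno (2007) as typed in ★ `RealUnitaryRankOneKAK`.
-/

set_option autoImplicit false

noncomputable section

-- Mathlib idiom (Mathlib/Algebra/Lie/OfAssociative.lean; as in ★ `GKModules`): the commutator bracket on matrices, to MENTION `𝔨`, `𝔤`, `Ad`.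
attribute [local instance 100] LieRing.ofAssociativeRing

open Matrix Complex Topology Filter
open scoped ComplexConjugate MatrixGroups Matrix.Norms.Operator
open NormedSpace

namespace Literature.RepresentationTheory.KonnoKonno2007

namespace RealDualPair

open Literature.NumberTheory.Automorphic Literature.RepresentationTheory.BorelWallach2000
open UForm

/-! ## §1 Matrix calculus helpers -/

/-- The matrix of `g · a_s` has derivative `(g · a_s) · H₀` (★ `hasDerivAt_coe_hypV` and a constant left factor). [cite: Knapp2002, I §10 Prop. 1.87] -/
theorem hasDerivAt_coe_mul_hypV (g : UForm (Fin 2) (Fin 1)) (s : ℝ) :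
    HasDerivAt (fun σ : ℝ => (((g * hypV (0 : Fin 2) (0 : Fin 1) σ : UForm (Fin 2) (Fin 1)) : GL (Fin 2 ⊕ Fin 1) ℂ) :
        Matrix (Fin 2 ⊕ Fin 1) (Fin 2 ⊕ Fin 1) ℂ))
      ((((g * hypV (0 : Fin 2) (0 : Fin 1) s : UForm (Fin 2) (Fin 1)) : GL (Fin 2 ⊕ Fin 1) ℂ) : Matrix (Fin 2 ⊕ Fin 1) (Fin 2 ⊕ Fin 1) ℂ) *
        ((upqUnit ((0 : Fin 2), (0 : Fin 1)) (-I) : (uFormGroup (Fin 2) (Fin 1)).lie) : Matrix (Fin 2 ⊕ Fin 1) (Fin 2 ⊕ Fin 1) ℂ)) s := by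
  have h := (hasDerivAt_coe_hypV (0 : Fin 2) (0 : Fin 1) (α := Fin 2) (β := Fin 1) s).const_mul
    (((g : UForm (Fin 2) (Fin 1)) : GL (Fin 2 ⊕ Fin 1) ℂ) : Matrix (Fin 2 ⊕ Fin 1) (Fin 2 ⊕ Fin 1) ℂ)
  simp only [UForm.coe_mul, Matrix.mul_assoc]
  exact h

/-- The inverse of a `K`-valued curve: if the matrix of `k` has derivative `k′` at `s₀`, the matrix of `s ↦ (k s)⁻¹` has derivative
`−k(s₀)⁻¹ k′ k(s₀)⁻¹` (Mathlib `hasFDerivAt_ringInverse`). [cite: Knapp2002, I §10 Prop. 1.89] -/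
theorem hasDerivAt_coe_inv_curve {k : ℝ → (uFormGroup (Fin 2) (Fin 1)).maximalCompact} {s₀ : ℝ} {k' : Matrix (Fin 2 ⊕ Fin 1) (Fin 2 ⊕ Fin 1) ℂ}
    (hk : HasDerivAt (fun s => (((k s : (uFormGroup (Fin 2) (Fin 1)).maximalCompact) : GL (Fin 2 ⊕ Fin 1) ℂ) : Matrix (Fin 2 ⊕ Fin 1) (Fin 2 ⊕ Fin 1) ℂ))
      k' s₀) :
    HasDerivAt (fun s => ((((k s)⁻¹ : (uFormGroup (Fin 2) (Fin 1)).maximalCompact) : GL (Fin 2 ⊕ Fin 1) ℂ) : Matrix (Fin 2 ⊕ Fin 1) (Fin 2 ⊕ Fin 1) ℂ))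
      (-(((((k s₀)⁻¹ : (uFormGroup (Fin 2) (Fin 1)).maximalCompact) : GL (Fin 2 ⊕ Fin 1) ℂ) : Matrix (Fin 2 ⊕ Fin 1) (Fin 2 ⊕ Fin 1) ℂ) * k' *
        ((((k s₀)⁻¹ : (uFormGroup (Fin 2) (Fin 1)).maximalCompact) : GL (Fin 2 ⊕ Fin 1) ℂ) : Matrix (Fin 2 ⊕ Fin 1) (Fin 2 ⊕ Fin 1) ℂ))) s₀ := by
  set u : GL (Fin 2 ⊕ Fin 1) ℂ := ((k s₀ : (uFormGroup (Fin 2) (Fin 1)).maximalCompact) : GL (Fin 2 ⊕ Fin 1) ℂ) with hu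
  have hinv : ∀ s, ((((k s)⁻¹ : (uFormGroup (Fin 2) (Fin 1)).maximalCompact) : GL (Fin 2 ⊕ Fin 1) ℂ) : Matrix (Fin 2 ⊕ Fin 1) (Fin 2 ⊕ Fin 1) ℂ) =
      Ring.inverse ((((k s : (uFormGroup (Fin 2) (Fin 1)).maximalCompact) : GL (Fin 2 ⊕ Fin 1) ℂ) : Matrix (Fin 2 ⊕ Fin 1) (Fin 2 ⊕ Fin 1) ℂ)) := by
    intro s; rw [Ring.inverse_unit, Subgroup.coe_inv]
  have h1 := (hasFDerivAt_ringInverse (𝕜 := ℝ) u).comp_hasDerivAt s₀ hk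
  have hfun : (fun s => ((((k s)⁻¹ : (uFormGroup (Fin 2) (Fin 1)).maximalCompact) : GL (Fin 2 ⊕ Fin 1) ℂ) : Matrix (Fin 2 ⊕ Fin 1) (Fin 2 ⊕ Fin 1) ℂ)) =
      Ring.inverse ∘ fun s => (((k s : (uFormGroup (Fin 2) (Fin 1)).maximalCompact) : GL (Fin 2 ⊕ Fin 1) ℂ) : Matrix (Fin 2 ⊕ Fin 1) (Fin 2 ⊕ Fin 1) ℂ) :=
    funext fun s => hinv s
  rw [hfun]
  refine h1.congr_deriv ?_
  rw [_root_.neg_apply, ContinuousLinearMap.mulLeftRight_apply, hinv s₀, Ring.inverse_unit]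

/-! ## §2 The `KAK` section along the torus translate `s ↦ g · a_s` -/

/-- **THE KAK SECTION ALONG `s ↦ g · a_s` NEAR A POINT OFF `K` («Φ2-geom»).**  For `g ∈ U(2,1)` and `s₀` with `g · a_{s₀} ∉ K` there are
`K`-valued curves `k₁, k₂`, a real function `τ` and `Y₁, Y₁′, Y₂ ∈ 𝔨`, `τ′ ∈ ℝ` with: `g a_s = k₁(s) a_{τ(s)} k₂(s)` for `s` near `s₀`
(★ S1b `secK₁`, `secT`, `secK₂`, through ★ `kakMap` ∕ ★ `upqMaximalCompactEquiv`); the matrices of `k₁`, `k₁⁻¹`, `k₂` have derivatives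
`k₁(s₀) Y₁`, `k₁(s₀)⁻¹ Y₁′`, `k₂(s₀) Y₂` at `s₀` (★ S1b differentiability + ★ `inv_mul_deriv_mem_compactLie`), `Y₁′ = −Ad(k₁(s₀)) Y₁`,
`HasDerivAt τ τ′ s₀`, and the derivative identity **(E1) `Ad(a_{−τ(s₀)}) Y₁ + τ′ H₀ + Ad(k₂(s₀)) Y₂ = Ad(k₂(s₀)) H₀`** in `𝔤` (differentiate
`g a_s = k₁ a_τ k₂` and `(g a_s)′ = g a_s H₀`, ★ `hasDerivAt_coe_hypV`).  Shapes = the hypotheses of ★-to-be `hasDerivAt_inner_globOp_mul_hypV`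
(Φ2-diff) at `(α, β, p₀, q₀) = (Fin 2, Fin 1, 0, 0)`. [cite: Knapp2002, VII §3 Thm. 7.39] [cite: Knapp2002, I §10 Prop. 1.87] -/
theorem exists_section_along_hypV (g : UForm (Fin 2) (Fin 1)) {s₀ : ℝ}
    (hs₀ : g * hypV (0 : Fin 2) (0 : Fin 1) s₀ ∉ Set.range (kV (Fin 2) (Fin 1))) :
    ∃ (k₁ k₂ : ℝ → (uFormGroup (Fin 2) (Fin 1)).maximalCompact) (τ : ℝ → ℝ)
      (Y₁ Y₁' Y₂ : (uFormGroup (Fin 2) (Fin 1)).compactLie) (τ' : ℝ),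
      (∀ᶠ s in 𝓝 s₀, g * hypV (0 : Fin 2) (0 : Fin 1) s =
        kakMap (0 : Fin 2) (0 : Fin 1) (upqMaximalCompactEquiv (k₁ s), τ s, upqMaximalCompactEquiv (k₂ s))) ∧
      HasDerivAt (fun s => (((k₁ s : (uFormGroup (Fin 2) (Fin 1)).maximalCompact) : GL (Fin 2 ⊕ Fin 1) ℂ) : Matrix (Fin 2 ⊕ Fin 1) (Fin 2 ⊕ Fin 1) ℂ))
        ((((k₁ s₀ : (uFormGroup (Fin 2) (Fin 1)).maximalCompact) : GL (Fin 2 ⊕ Fin 1) ℂ) : Matrix (Fin 2 ⊕ Fin 1) (Fin 2 ⊕ Fin 1) ℂ) *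
          (Y₁ : Matrix (Fin 2 ⊕ Fin 1) (Fin 2 ⊕ Fin 1) ℂ)) s₀ ∧
      HasDerivAt (fun s => ((((k₁ s)⁻¹ : (uFormGroup (Fin 2) (Fin 1)).maximalCompact) : GL (Fin 2 ⊕ Fin 1) ℂ) : Matrix (Fin 2 ⊕ Fin 1) (Fin 2 ⊕ Fin 1) ℂ))
        (((((k₁ s₀)⁻¹ : (uFormGroup (Fin 2) (Fin 1)).maximalCompact) : GL (Fin 2 ⊕ Fin 1) ℂ) : Matrix (Fin 2 ⊕ Fin 1) (Fin 2 ⊕ Fin 1) ℂ) *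
          (Y₁' : Matrix (Fin 2 ⊕ Fin 1) (Fin 2 ⊕ Fin 1) ℂ)) s₀ ∧
      (LieSubalgebra.inclusion (uFormGroup (Fin 2) (Fin 1)).compactLie_le_lie Y₁' : (uFormGroup (Fin 2) (Fin 1)).lie) =
        -(uFormGroup (Fin 2) (Fin 1)).Ad (Subgroup.inclusion (uFormGroup (Fin 2) (Fin 1)).maximalCompact_le_carrier (k₁ s₀))
          (LieSubalgebra.inclusion (uFormGroup (Fin 2) (Fin 1)).compactLie_le_lie Y₁) ∧
      HasDerivAt (fun s => (((k₂ s : (uFormGroup (Fin 2) (Fin 1)).maximalCompact) : GL (Fin 2 ⊕ Fin 1) ℂ) : Matrix (Fin 2 ⊕ Fin 1) (Fin 2 ⊕ Fin 1) ℂ))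
        ((((k₂ s₀ : (uFormGroup (Fin 2) (Fin 1)).maximalCompact) : GL (Fin 2 ⊕ Fin 1) ℂ) : Matrix (Fin 2 ⊕ Fin 1) (Fin 2 ⊕ Fin 1) ℂ) *
          (Y₂ : Matrix (Fin 2 ⊕ Fin 1) (Fin 2 ⊕ Fin 1) ℂ)) s₀ ∧
      HasDerivAt τ τ' s₀ ∧
      (uFormGroup (Fin 2) (Fin 1)).Ad ((uFormGroup (Fin 2) (Fin 1)).expMem ((-τ s₀) • upqUnit ((0 : Fin 2), (0 : Fin 1)) (-I)))
          (LieSubalgebra.inclusion (uFormGroup (Fin 2) (Fin 1)).compactLie_le_lie Y₁) +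
        τ' • upqUnit ((0 : Fin 2), (0 : Fin 1)) (-I) +
        (uFormGroup (Fin 2) (Fin 1)).Ad (Subgroup.inclusion (uFormGroup (Fin 2) (Fin 1)).maximalCompact_le_carrier (k₂ s₀))
          (LieSubalgebra.inclusion (uFormGroup (Fin 2) (Fin 1)).compactLie_le_lie Y₂) =
        (uFormGroup (Fin 2) (Fin 1)).Ad (Subgroup.inclusion (uFormGroup (Fin 2) (Fin 1)).maximalCompact_le_carrier (k₂ s₀))
          (upqUnit ((0 : Fin 2), (0 : Fin 1)) (-I)) := by
  -- abbreviations
  set G := uFormGroup (Fin 2) (Fin 1) with hGdef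
  have hreg : ∀ X : Matrix (Fin 2 ⊕ Fin 1) (Fin 2 ⊕ Fin 1) ℂ, (∀ t : ℝ, expGL (t • X) ∈ G.carrier) → X ∈ G.lie := uFormGroup_regular
  let Mx : UForm (Fin 2) (Fin 1) → Matrix (Fin 2 ⊕ Fin 1) (Fin 2 ⊕ Fin 1) ℂ := fun x => ((x : GL (Fin 2 ⊕ Fin 1) ℂ) : Matrix _ _ ℂ)
  let γ : ℝ → Matrix (Fin 2 ⊕ Fin 1) (Fin 2 ⊕ Fin 1) ℂ := fun s => Mx (g * hypV (0 : Fin 2) (0 : Fin 1) s)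
  let H₀m : Matrix (Fin 2 ⊕ Fin 1) (Fin 2 ⊕ Fin 1) ℂ := ((upqUnit ((0 : Fin 2), (0 : Fin 1)) (-I) : G.lie) : Matrix _ _ ℂ)
  have hγ : ∀ s, HasDerivAt γ (γ s * H₀m) s := fun s => hasDerivAt_coe_mul_hypV g s
  have hcorner : ∀ s, γ s (Sum.inr 0) (Sum.inr 0) ≠ 0 := fun s => corner_ne_zero (g * hypV (0 : Fin 2) (0 : Fin 1) s)
  have hr₀ : rowNorm (γ s₀) ≠ 0 := (rowNorm_ne_zero_iff_not_mem_range_kV _).2 hs₀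
  -- the section curves (junk `1` where `g a_s ∈ K`)
  classical
  let q₂ : ℝ → KV (Fin 2) (Fin 1) := fun s => if h : rowNorm (γ s) ≠ 0 then secKV₂ (γ s) h (hcorner s) else 1
  let q₁ : ℝ → KV (Fin 2) (Fin 1) := fun s => if h : rowNorm (γ s) ≠ 0 then secKV₁ (g * hypV (0 : Fin 2) (0 : Fin 1) s) h else 1
  let k₂ : ℝ → G.maximalCompact := fun s => upqMaximalCompactEquiv.symm (q₂ s)
  let k₁ : ℝ → G.maximalCompact := fun s => upqMaximalCompactEquiv.symm (q₁ s)
  let τ : ℝ → ℝ := fun s => secT (γ s)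
  -- matrices of the section curves where `‖r‖ ≠ 0`
  have hk₂M : ∀ s, ∀ h : rowNorm (γ s) ≠ 0, (((k₂ s : G.maximalCompact) : GL (Fin 2 ⊕ Fin 1) ℂ) : Matrix _ _ ℂ) = secK₂ (γ s) := by
    intro s h
    simp only [k₂, q₂, dif_pos h, coe_upqMaximalCompactEquiv_symm_apply, coe_kV_secKV₂]
  have hk₁M : ∀ s, ∀ h : rowNorm (γ s) ≠ 0, (((k₁ s : G.maximalCompact) : GL (Fin 2 ⊕ Fin 1) ℂ) : Matrix _ _ ℂ) = secK₁ (γ s) := by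
    intro s h
    simp only [k₁, q₁, dif_pos h, coe_upqMaximalCompactEquiv_symm_apply, coe_kV_secKV₁]
    rfl
  -- `‖r(γ s)‖ ≠ 0` near `s₀`
  have hev : ∀ᶠ s in 𝓝 s₀, rowNorm (γ s) ≠ 0 := by
    have hc : ContinuousAt (fun s => rowNorm (γ s)) s₀ :=
      ((differentiableAt_rowNorm _ hr₀).continuousAt).comp (hγ s₀).continuousAt
    exact hc.eventually_ne hr₀
  -- (1) the section identity near `s₀`
  have h1 : ∀ᶠ s in 𝓝 s₀, g * hypV (0 : Fin 2) (0 : Fin 1) s =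
      kakMap (0 : Fin 2) (0 : Fin 1) (upqMaximalCompactEquiv (k₁ s), τ s, upqMaximalCompactEquiv (k₂ s)) := by
    filter_upwards [hev] with s h
    have e₁ : upqMaximalCompactEquiv (k₁ s) = q₁ s := upqMaximalCompactEquiv.apply_symm_apply _
    have e₂ : upqMaximalCompactEquiv (k₂ s) = q₂ s := upqMaximalCompactEquiv.apply_symm_apply _
    rw [e₁, e₂]
    simp only [q₁, q₂, dif_pos h]
    exact (kakMap_secKV (g * hypV (0 : Fin 2) (0 : Fin 1) s) h).symm
  -- its matrix form
  have h1m : ∀ᶠ s in 𝓝 s₀, γ s = (((k₁ s : G.maximalCompact) : GL (Fin 2 ⊕ Fin 1) ℂ) : Matrix _ _ ℂ) * Mx (hypV (0 : Fin 2) (0 : Fin 1) (τ s)) *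
      (((k₂ s : G.maximalCompact) : GL (Fin 2 ⊕ Fin 1) ℂ) : Matrix _ _ ℂ) := by
    filter_upwards [hev] with s h
    rw [hk₁M s h, hk₂M s h]
    exact (secK₁_mul_hypV_mul_secK₂ (γ s) h (hcorner s)).symm
  -- (2) derivatives of the matrices of `k₁`, `k₂` at `s₀` (they agree with `secKᵢ ∘ γ` near `s₀`)
  have hγd : DifferentiableAt ℝ γ s₀ := (hγ s₀).differentiableAt
  have hK₂ : HasDerivAt (fun s => (((k₂ s : G.maximalCompact) : GL (Fin 2 ⊕ Fin 1) ℂ) : Matrix _ _ ℂ))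
      (deriv (fun s => secK₂ (γ s)) s₀) s₀ := by
    have hd := (differentiableAt_secK₂_comp hγd hr₀ (hcorner s₀)).hasDerivAt
    refine hd.congr_of_eventuallyEq ?_
    filter_upwards [hev] with s h
    exact hk₂M s h
  have hK₁ : HasDerivAt (fun s => (((k₁ s : G.maximalCompact) : GL (Fin 2 ⊕ Fin 1) ℂ) : Matrix _ _ ℂ))
      (deriv (fun s => secK₁ (γ s)) s₀) s₀ := by
    have hd := (differentiableAt_secK₁_comp hγd hr₀ (hcorner s₀)).hasDerivAt
    refine hd.congr_of_eventuallyEq ?_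
    filter_upwards [hev] with s h
    exact hk₁M s h
  set D₁ := deriv (fun s => secK₁ (γ s)) s₀ with hD₁
  set D₂ := deriv (fun s => secK₂ (γ s)) s₀ with hD₂
  -- the log-derivatives `Yᵢ = kᵢ(s₀)⁻¹ Dᵢ ∈ 𝔨`
  set K₁ := (((k₁ s₀ : G.maximalCompact) : GL (Fin 2 ⊕ Fin 1) ℂ) : Matrix (Fin 2 ⊕ Fin 1) (Fin 2 ⊕ Fin 1) ℂ) with hK₁def
  set K₁i := ((((k₁ s₀)⁻¹ : G.maximalCompact) : GL (Fin 2 ⊕ Fin 1) ℂ) : Matrix (Fin 2 ⊕ Fin 1) (Fin 2 ⊕ Fin 1) ℂ) with hK₁idef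
  set K₂ := (((k₂ s₀ : G.maximalCompact) : GL (Fin 2 ⊕ Fin 1) ℂ) : Matrix (Fin 2 ⊕ Fin 1) (Fin 2 ⊕ Fin 1) ℂ) with hK₂def
  set K₂i := ((((k₂ s₀)⁻¹ : G.maximalCompact) : GL (Fin 2 ⊕ Fin 1) ℂ) : Matrix (Fin 2 ⊕ Fin 1) (Fin 2 ⊕ Fin 1) ℂ) with hK₂idef
  have hK₁iK₁ : K₁i * K₁ = 1 := by rw [hK₁idef, hK₁def, ← Units.val_mul, ← Subgroup.coe_mul, inv_mul_cancel]; rfl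
  have hK₁K₁i : K₁ * K₁i = 1 := by rw [hK₁idef, hK₁def, ← Units.val_mul, ← Subgroup.coe_mul, mul_inv_cancel]; rfl
  have hK₂iK₂ : K₂i * K₂ = 1 := by rw [hK₂idef, hK₂def, ← Units.val_mul, ← Subgroup.coe_mul, inv_mul_cancel]; rfl
  have hK₂K₂i : K₂ * K₂i = 1 := by rw [hK₂idef, hK₂def, ← Units.val_mul, ← Subgroup.coe_mul, mul_inv_cancel]; rfl
  let Y₁ : G.compactLie := ⟨K₁i * D₁, IsGKModule.inv_mul_deriv_mem_compactLie hreg hK₁⟩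
  let Y₂ : G.compactLie := ⟨K₂i * D₂, IsGKModule.inv_mul_deriv_mem_compactLie hreg hK₂⟩
  have hK₁Y : HasDerivAt (fun s => (((k₁ s : G.maximalCompact) : GL (Fin 2 ⊕ Fin 1) ℂ) : Matrix _ _ ℂ)) (K₁ * (Y₁ : Matrix _ _ ℂ)) s₀ :=
    hK₁.congr_deriv (by change D₁ = K₁ * (K₁i * D₁); rw [← Matrix.mul_assoc, hK₁K₁i, Matrix.one_mul])
  have hK₂Y : HasDerivAt (fun s => (((k₂ s : G.maximalCompact) : GL (Fin 2 ⊕ Fin 1) ℂ) : Matrix _ _ ℂ)) (K₂ * (Y₂ : Matrix _ _ ℂ)) s₀ :=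
    hK₂.congr_deriv (by change D₂ = K₂ * (K₂i * D₂); rw [← Matrix.mul_assoc, hK₂K₂i, Matrix.one_mul])
  -- the inverse curve `k₁⁻¹` and its log-derivative `Y₁' = −Ad(k₁) Y₁`
  have hK₁inv := hasDerivAt_coe_inv_curve hK₁
  have hY₁'mem : K₁ * (-(K₁i * D₁ * K₁i)) ∈ G.compactLie := by
    have h := IsGKModule.inv_mul_deriv_mem_compactLie hreg hK₁inv
    rwa [inv_inv] at h
  let Y₁' : G.compactLie := ⟨K₁ * (-(K₁i * D₁ * K₁i)), hY₁'mem⟩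
  have hK₁invY : HasDerivAt (fun s => ((((k₁ s)⁻¹ : G.maximalCompact) : GL (Fin 2 ⊕ Fin 1) ℂ) : Matrix _ _ ℂ)) (K₁i * (Y₁' : Matrix _ _ ℂ)) s₀ :=
    hK₁inv.congr_deriv (by
      change -(K₁i * D₁ * K₁i) = K₁i * (K₁ * (-(K₁i * D₁ * K₁i)))
      rw [← Matrix.mul_assoc, hK₁iK₁, Matrix.one_mul])
  have hY₁' : (LieSubalgebra.inclusion G.compactLie_le_lie Y₁' : G.lie) =
      -G.Ad (Subgroup.inclusion G.maximalCompact_le_carrier (k₁ s₀)) (LieSubalgebra.inclusion G.compactLie_le_lie Y₁) := by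
    apply Subtype.ext
    change K₁ * (-(K₁i * D₁ * K₁i)) = -(K₁ * (K₁i * D₁) * K₁i)
    rw [Matrix.mul_neg, Matrix.mul_assoc, Matrix.mul_assoc, Matrix.mul_assoc]
  -- (4) `τ`
  have hτ : HasDerivAt τ (deriv τ s₀) s₀ := (differentiableAt_secT_comp hγd hr₀).hasDerivAt
  set τ' := deriv τ s₀ with hτ'
  -- (5) the derivative identity (E1)
  let A : ℝ → Matrix (Fin 2 ⊕ Fin 1) (Fin 2 ⊕ Fin 1) ℂ := fun t => Mx (hypV (0 : Fin 2) (0 : Fin 1) t)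
  have hA : HasDerivAt (fun s => A (τ s)) (τ' • (A (τ s₀) * H₀m)) s₀ :=
    (hasDerivAt_coe_hypV (0 : Fin 2) (0 : Fin 1) (α := Fin 2) (β := Fin 1) (τ s₀)).scomp s₀ hτ
  have hprod : HasDerivAt (fun s => (((k₁ s : G.maximalCompact) : GL (Fin 2 ⊕ Fin 1) ℂ) : Matrix _ _ ℂ) * A (τ s) *
      (((k₂ s : G.maximalCompact) : GL (Fin 2 ⊕ Fin 1) ℂ) : Matrix _ _ ℂ))
      ((K₁ * (Y₁ : Matrix _ _ ℂ) * A (τ s₀) + K₁ * (τ' • (A (τ s₀) * H₀m))) * K₂ + K₁ * A (τ s₀) * (K₂ * (Y₂ : Matrix _ _ ℂ))) s₀ :=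
    (hK₁Y.mul hA).mul hK₂Y
  have hγ' : HasDerivAt γ ((K₁ * (Y₁ : Matrix _ _ ℂ) * A (τ s₀) + K₁ * (τ' • (A (τ s₀) * H₀m))) * K₂ + K₁ * A (τ s₀) * (K₂ * (Y₂ : Matrix _ _ ℂ))) s₀ :=
    hprod.congr_of_eventuallyEq (h1m.mono fun s hs => hs)
  have huniq : γ s₀ * H₀m = (K₁ * (Y₁ : Matrix _ _ ℂ) * A (τ s₀) + K₁ * (τ' • (A (τ s₀) * H₀m))) * K₂ + K₁ * A (τ s₀) * (K₂ * (Y₂ : Matrix _ _ ℂ)) :=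
    (hγ s₀).unique hγ'
  have hγ₀ : γ s₀ = K₁ * A (τ s₀) * K₂ := h1m.self_of_nhds
  -- the inverse of `a_{τ₀}` is `a_{−τ₀}`
  have hAinv : A (-τ s₀) * A (τ s₀) = 1 := by
    change Mx (hypV 0 0 (-τ s₀)) * Mx (hypV 0 0 (τ s₀)) = 1
    rw [← UForm.coe_mul, ← hypV_add, neg_add_cancel, hypV_zero]; rfl
  -- multiply `huniq` by `A(−τ₀) K₁⁻¹` on the left and `K₂⁻¹` on the right, and cancel
  have hcK : ∀ X : Matrix (Fin 2 ⊕ Fin 1) (Fin 2 ⊕ Fin 1) ℂ, K₁i * (K₁ * X) = X := fun X => by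
    rw [← Matrix.mul_assoc, hK₁iK₁, Matrix.one_mul]
  have hcA : ∀ X : Matrix (Fin 2 ⊕ Fin 1) (Fin 2 ⊕ Fin 1) ℂ, A (-τ s₀) * (A (τ s₀) * X) = X := fun X => by
    rw [← Matrix.mul_assoc, hAinv, Matrix.one_mul]
  have hE1m : A (-τ s₀) * ((Y₁ : Matrix _ _ ℂ) * A (τ s₀)) + τ' • H₀m + K₂ * ((Y₂ : Matrix _ _ ℂ) * K₂i) = K₂ * (H₀m * K₂i) := by
    have h := congrArg (fun X => A (-τ s₀) * K₁i * X * K₂i) huniq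
    simp only [hγ₀, Matrix.mul_add, Matrix.add_mul, Matrix.mul_assoc, Matrix.mul_smul, Matrix.smul_mul, hcK, hcA, hK₂K₂i,
      Matrix.mul_one] at h
    exact h.symm
  -- (E1) in `𝔤`
  have hE1 : G.Ad (G.expMem ((-τ s₀) • upqUnit ((0 : Fin 2), (0 : Fin 1)) (-I))) (LieSubalgebra.inclusion G.compactLie_le_lie Y₁) +
        τ' • upqUnit ((0 : Fin 2), (0 : Fin 1)) (-I) +
        G.Ad (Subgroup.inclusion G.maximalCompact_le_carrier (k₂ s₀)) (LieSubalgebra.inclusion G.compactLie_le_lie Y₂) =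
      G.Ad (Subgroup.inclusion G.maximalCompact_le_carrier (k₂ s₀)) (upqUnit ((0 : Fin 2), (0 : Fin 1)) (-I)) := by
    have hexp : G.expMem ((-τ s₀) • upqUnit ((0 : Fin 2), (0 : Fin 1)) (-I)) = (hypV (0 : Fin 2) (0 : Fin 1) (-τ s₀) : UForm (Fin 2) (Fin 1)) :=
      expMem_smul_boostUnit (0 : Fin 2) (0 : Fin 1) (-τ s₀)
    have hexpi : (G.expMem ((-τ s₀) • upqUnit ((0 : Fin 2), (0 : Fin 1)) (-I)))⁻¹ = (hypV (0 : Fin 2) (0 : Fin 1) (τ s₀) : UForm (Fin 2) (Fin 1)) := by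
      rw [hexp]
      change (hypV (0 : Fin 2) (0 : Fin 1) (-τ s₀) : UForm (Fin 2) (Fin 1))⁻¹ = _
      rw [hypV_neg, inv_inv]
    have hexpm : (((G.expMem ((-τ s₀) • upqUnit ((0 : Fin 2), (0 : Fin 1)) (-I)) : G.carrier) : GL (Fin 2 ⊕ Fin 1) ℂ) : Matrix _ _ ℂ) =
        A (-τ s₀) := by rw [hexp]
    have hexpim : ((((G.expMem ((-τ s₀) • upqUnit ((0 : Fin 2), (0 : Fin 1)) (-I)) : G.carrier) : GL (Fin 2 ⊕ Fin 1) ℂ)⁻¹ : GL (Fin 2 ⊕ Fin 1) ℂ) :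
        Matrix _ _ ℂ) = A (τ s₀) := by rw [← Subgroup.coe_inv, hexpi]
    have hK₂i' : ((((k₂ s₀ : G.maximalCompact) : GL (Fin 2 ⊕ Fin 1) ℂ)⁻¹ : GL (Fin 2 ⊕ Fin 1) ℂ) : Matrix _ _ ℂ) = K₂i := by
      rw [hK₂idef, ← Subgroup.coe_inv]
    apply Subtype.ext
    change (((G.expMem ((-τ s₀) • upqUnit ((0 : Fin 2), (0 : Fin 1)) (-I)) : G.carrier) : GL (Fin 2 ⊕ Fin 1) ℂ) : Matrix _ _ ℂ) * (Y₁ : Matrix _ _ ℂ) *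
          ((((G.expMem ((-τ s₀) • upqUnit ((0 : Fin 2), (0 : Fin 1)) (-I)) : G.carrier) : GL (Fin 2 ⊕ Fin 1) ℂ)⁻¹ : GL (Fin 2 ⊕ Fin 1) ℂ) : Matrix _ _ ℂ) +
        τ' • H₀m + K₂ * (Y₂ : Matrix _ _ ℂ) * ((((k₂ s₀ : G.maximalCompact) : GL (Fin 2 ⊕ Fin 1) ℂ)⁻¹ : GL (Fin 2 ⊕ Fin 1) ℂ) : Matrix _ _ ℂ) =
      K₂ * H₀m * ((((k₂ s₀ : G.maximalCompact) : GL (Fin 2 ⊕ Fin 1) ℂ)⁻¹ : GL (Fin 2 ⊕ Fin 1) ℂ) : Matrix _ _ ℂ)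
    rw [hexpm, hexpim, hK₂i']
    simpa only [Matrix.mul_assoc] using hE1m
  exact ⟨k₁, k₂, τ, Y₁, Y₁', Y₂, τ', h1, hK₁Y, hK₁invY, hY₁', hK₂Y, hτ, hE1⟩

end RealDualPair

end Literature.RepresentationTheory.KonnoKonno2007

end
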